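import Mathlib
import Literature.NumberTheory.LFunctions.Zhang2022.Section7cMellinStep
import Literature.NumberTheory.LFunctions.Zhang2022.Section7Step7bTruncI
import HarnessLib

/-!
# Zhang (2022) §7/(14.8)/(14.6): the `b`-error chain with GENERIC coefficients — the Mellin step for
# `𝔰*` and the `l ∉ 𝔌(Rh)` localisation `𝔰 ↦ 𝔰*`, kernel-checked once for all instances

Topic `Literature/NumberTheory/LFunctions/Zhang2022` (Landau–Siegel audit tree; verdict-neutral).
Y. Zhang, *Discrete mean estimates and the Landau–Siegel zero*, arXiv:2211.02515v1 (2022)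
[Zhang2022LandauSiegel] — **an unrefereed manuscript under adjudication**; nothing here asserts or
denies its Theorems 1–2 or Propositions 7.1/14.1. ZHANG-L discharge lane, helper block under the leaf
`Skeleton.Prop141` (GAP row G-adj2-4: "the (14.8)-left-side bound … for `D³ ≤ r < 2DP₄` (Mellin +
L5.4(i) + large sieve leg), and the (14.6) analogue"), LIB-PLAN §2 items B1–B4 ("the coefficient-generic
form of the PROVED §7 b-error chain").

The §7 error-term chain (p. 38, tex L2030–L2046) — proved in the tree for the SPECIFIC coefficients
`(κ∗𝐚₁)(dl)` and the prime weight `p^{β₃}` (`Section7TruncI.step7bTruncI_holds`,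
`Section7cMellin.frakSstar_eq_integral` / `norm_frakSstar_le` / `step7u038R_holds`) — is re-run in §14
for (14.8) ("In a way similar to the proof of Proposition 7.1 … for `D³ ≤ r < 2DP₄` we use the Mellin
transform, Lemma 5.4 (i) and the large sieve inequality", p. 79, tex L3960–L3963) with the coefficients
`κ*(dl)` and the prime weight `χ(p)` (and `χ(p)(pt₀)^β` for general `β`), and for (14.6) ("similar",
p. 79) with `κ*(D₁dl)`. This file proves the two per-block inputs of that dyadic large-sieve leg ONCE,
for ARBITRARY `l`-coefficients `c` and an ARBITRARY prime weight `w` (theorems, plus the four generic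
objects they speak about; no Assumption (A), no manuscript claim asserted):

* objects `lPolyGen` (`Σ_{l∈𝔌(Rh),(l,h)=1} c(l)θ(l)l^{−s}`), `pPolyGen` (`Σ_{p∼P} w(p)θ̄(p)p^{s}`),
  `frakSGen` (`𝔰 = Σ_{(l,h)=1} c(l)θ(l)Σ_{p∼P} w(p)θ̄(p)Δ(l/(phr))`, a series in `l`) and `frakSstarGen`
  (`𝔰*`, the same over `l ∈ 𝔌(Rh)`), over the tree's `Section7cStatements.natI` (`𝔌(y)`);
* `frakSstarGen_eq_integral` — **the Mellin step, exact**: for all large `D`,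
  `𝔰* = (1/2π)∫ δ(1+it)·(hr)^{1+it}·lPolyGen(1+it)·pPolyGen(1+it) dt` (tree `Skeleton.DeltaW_eq_mellinInv`);
* `norm_frakSstarGen_le` — `|𝔰*| ≤ hr·(1/2π)·∫|δ(1+it)|·|lPolyGen(1+it)|·|pPolyGen(1+it)|dt` with the
  integrand integrable; `norm_frakSstarGen_le_ellPow` — by Lemma 5.4 (i) on `σ = 1` (tree
  `Skeleton.norm_deltaW_line_le`): `|𝔰*| ≤ K·𝓛⁵¹⁹⁰·hr·∫|lPolyGen|·|pPolyGen|dt/(1+t²)` (Z22 §7.u038 /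
  §14 p.79 "by the Mellin transform and Lemma 5.4 (i)", generic form, with the factor `hr` the
  printed display omits, cf. GAP-LEDGER G-d26-1);
* `norm_frakSGen_sub_frakSstarGen_le` — **the localisation `𝔰 ↦ 𝔰*`** (Z22 §7.u037 "By Lemma 5.1,
  for `R ≤ r < 2R`, the terms with `l ∉ 𝔌(Rh)` … make a negligible contribution", re-used on p. 79):
  there is an absolute `c > 0` with, for all large `D`, every `c, w` with `|c(l)| ≤ B(dl)⁴`,
  `|w(p)| ≤ W` on the window, `1 ≤ d ≤ P`, `h ≥ 1`, `0 < R`, `hR ≤ P`, `R ≤ r < 2R`, any `θ (mod r)`: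
  `|𝔰 − 𝔰*| ≤ B·W·exp(−c𝓛¹⁰)` (from the tree's `DeltaFar.norm_DeltaW_le_of_far` and
  `Section7TruncI.far_of_not_mem_natI`; the constants `B`, `W` are carried explicitly so that the
  threshold in `D` is absolute).

Instances: §7 (`c(l) = (κ∗𝐚₁)(dl)`, `w(p) = p^{β₃}`, ranges (7.15)); (14.8) (`c(l) = κ*(dl)`,
`w(p) = χ(p)`, `Dk = hr`, `h < P/r`, so `hR ≤ P`); (14.6) (`c(l) = κ*(D₁dl)`); the general-`β` form of
Proposition 14.1 (`w(p) = χ(p)(pt₀)^β`, `|w| ≤ e^{5π+1}`). The companion large-sieve/Cauchy steps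
(B1–B3) and the dyadic aggregation (B4) are separate files of the block.

## References

* Y. Zhang, arXiv:2211.02515v1 (2022), §7 p. 38 (tex L2030–L2046), §14 pp. 78–79 ((14.6), (14.8),
  tex L3915, L3945–L3969); §5 (5.14), Lemmas 5.3, 5.4 (i). [cite: Zhang2022LandauSiegel, §7 p.38; §14 p.79]
-/

noncomputable section

open Complex Real Set MeasureTheory Filter Topology
open Literature.NumberTheory.LFunctions.Zhang2022.Section7cStatements (natI dyadic)

namespace Literature.NumberTheory.LFunctions.Zhang2022.BErrorChain

open Skeleton
open scoped Classical

/-! ### §0. The generic objects of the block -/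

/-- The generic `l`-polynomial `Σ_{l∈𝔌(Rh), (l,h)=1} c(l)θ(l)l^{−s}` for a character `θ (mod r)`
(§7.u038–u039 with `c(l) = (κ∗𝐚₁)(dl)`; §14 p. 79 with `c(l) = κ*(dl)` resp. `κ*(D₁dl)`).
[cite: Zhang2022LandauSiegel, §7 p.38, tex L2044] -/
def lPolyGen (D : ℕ) (c : ℕ → ℂ) (R : ℝ) (r h : ℕ) (θ : DirichletCharacter ℂ r) (s : ℂ) : ℂ :=
  ∑ l ∈ (natI D (R * h)).filter (fun l => Nat.Coprime l h), c l * θ (l : ZMod r) * (l : ℂ) ^ (-s)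

/-- The generic prime polynomial `Σ_{p∼P} w(p)θ̄(p)p^{s}` for a character `θ (mod r)` and a weight `w` on
the prime window (§7: `w(p) = p^{β₃}`; (14.8): `w(p) = χ(p)`, general `β`: `χ(p)(pt₀)^β`).
[cite: Zhang2022LandauSiegel, §7 (7.14) p.38, tex L2010] -/
def pPolyGen (D : ℕ) (w : ℕ → ℂ) (r : ℕ) (θ : DirichletCharacter ℂ r) (s : ℂ) : ℂ :=
  ∑ p ∈ primeWindow D, w p * θ⁻¹ (p : ZMod r) * (p : ℂ) ^ s

/-- The generic `𝔰(r,h;θ) = Σ_{(l,h)=1} c(l)θ(l) Σ_{p∼P} w(p)θ̄(p)Δ(l/(phr))` (a series in `l ≥ 1`;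
§7.u032 `𝔰(r,h,d;θ)` is `c(l) = (κ∗𝐚₁)(dl)`, `w(p) = p^{β₃}`; the summand of (14.8)/u017 is
`c(l) = κ*(dl)`, `w(p) = χ(p)`). [cite: Zhang2022LandauSiegel, §7 p.37, tex L2001; §14 (14.8) p.79] -/
def frakSGen (D : ℕ) (c w : ℕ → ℂ) (r h : ℕ) (θ : DirichletCharacter ℂ r) : ℂ :=
  ∑' l : ℕ, if Nat.Coprime l h then
    c l * θ (l : ZMod r) *
      ∑ p ∈ primeWindow D, w p * θ⁻¹ (p : ZMod r) * DeltaW D ((l : ℝ) / ((p : ℝ) * h * r))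
    else 0

/-- The generic localised sum `𝔰*(R,r,h;θ) = Σ_{l∈𝔌(Rh), (l,h)=1} c(l)θ(l) Σ_{p∼P} w(p)θ̄(p)Δ(l/(phr))`
(a finite sum; §7.u037 `𝔰*(R,r,h,d;θ)`). [cite: Zhang2022LandauSiegel, §7 p.38, tex L2039] -/
def frakSstarGen (D : ℕ) (c w : ℕ → ℂ) (R : ℝ) (r h : ℕ) (θ : DirichletCharacter ℂ r) : ℂ :=
  ∑ l ∈ (natI D (R * h)).filter (fun l => Nat.Coprime l h),
    c l * θ (l : ZMod r) *
      ∑ p ∈ primeWindow D, w p * θ⁻¹ (p : ZMod r) * DeltaW D ((l : ℝ) / ((p : ℝ) * h * r))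

/-! ### §1. Plumbing: the line `s = 1 + it` -/

/-- `t ↦ x^{−(1+it)}` (`x > 0`) is continuous. [folklore] -/
private theorem continuous_cpow_neg_line {x : ℝ} (hx : 0 < x) :
    Continuous fun t : ℝ => (x : ℂ) ^ (-(1 + t * I)) :=
  (continuous_iff_continuousAt.mpr fun b =>
    continuousAt_const_cpow (ofReal_ne_zero.mpr hx.ne')).comp (by fun_prop)

/-- `t ↦ x^{1+it}` (`x > 0`) is continuous. [folklore] -/
private theorem continuous_cpow_line {x : ℝ} (hx : 0 < x) :
    Continuous fun t : ℝ => (x : ℂ) ^ (1 + (t : ℂ) * I) :=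
  (continuous_iff_continuousAt.mpr fun b =>
    continuousAt_const_cpow (ofReal_ne_zero.mpr hx.ne')).comp (by fun_prop)

/-- `‖x^{−(1+it)}‖ = x⁻¹` and `‖x^{1+it}‖ = x` for `x > 0`. [folklore] -/
private theorem norm_cpow_line {x : ℝ} (hx : 0 < x) (t : ℝ) :
    ‖(x : ℂ) ^ (-(1 + t * I))‖ = x⁻¹ ∧ ‖(x : ℂ) ^ (1 + (t : ℂ) * I)‖ = x :=
  ⟨by rw [Complex.norm_cpow_eq_rpow_re_of_pos hx]; simp [Real.rpow_neg_one],
   by rw [Complex.norm_cpow_eq_rpow_re_of_pos hx]; simp⟩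

/-- The Mellin kernel at `x = c/p` splits: `(c/p)^{−s} = (c⁻¹)^{s}·p^{s}` (`s = 1+it`, `c > 0`). [folklore] -/
private theorem cpow_kernel_eq {c : ℝ} (hc : 0 < c) {p : ℕ} (hp : 0 < p) (t : ℝ) :
    (((c / p : ℝ)) : ℂ) ^ (-(1 + (t : ℂ) * I))
      = ((c⁻¹ : ℝ) : ℂ) ^ (1 + (t : ℂ) * I) * ((p : ℕ) : ℂ) ^ (1 + (t : ℂ) * I) := by
  set s : ℂ := 1 + (t : ℂ) * I with hs
  have hxpos : 0 < c / p := by positivity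
  have harg : (((c / p : ℝ)) : ℂ).arg ≠ π := by
    rw [Complex.arg_ofReal_of_nonneg hxpos.le]; exact Real.pi_ne_zero.symm
  rw [Complex.cpow_neg, ← Complex.inv_cpow _ s harg, ← Complex.ofReal_inv, inv_div,
    show (p : ℝ) / c = c⁻¹ * (p : ℝ) by rw [div_eq_mul_inv, mul_comm], Complex.ofReal_mul,
    Complex.mul_cpow_ofReal_nonneg (inv_nonneg.mpr hc.le) (Nat.cast_nonneg p)]
  norm_cast

/-- `(a/b)^{s} = a^{s}·b^{−s}` for positive reals. [folklore] -/
private theorem cpow_div_eq {a b : ℝ} (ha : 0 < a) (hb : 0 < b) (s : ℂ) :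
    (((a / b : ℝ)) : ℂ) ^ s = (a : ℂ) ^ s * (b : ℂ) ^ (-s) := by
  have hbarg : ((b : ℝ) : ℂ).arg ≠ π := by
    rw [Complex.arg_ofReal_of_nonneg hb.le]; exact Real.pi_ne_zero.symm
  rw [show (a / b : ℝ) = a * b⁻¹ from div_eq_mul_inv a b, Complex.ofReal_mul,
    Complex.mul_cpow_ofReal_nonneg ha.le (inv_nonneg.mpr hb.le), Complex.ofReal_inv,
    Complex.inv_cpow _ _ hbarg, Complex.cpow_neg]

/-- The generic prime polynomial on `σ = 1` is `Σ_{p∼P} (w(p)θ̄(p))·p^{1+it}` (definitional regrouping).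
[cite: Zhang2022LandauSiegel, §7 (7.14) p.38] -/
theorem primeSum_eq_pPolyGen (D : ℕ) (w : ℕ → ℂ) (r : ℕ) (θ : DirichletCharacter ℂ r) (t : ℝ) :
    ∑ p ∈ primeWindow D, (w p * θ⁻¹ (p : ZMod r)) * (p : ℂ) ^ (1 + (t : ℂ) * I)
      = pPolyGen D w r θ (1 + t * I) := rfl

/-- `t ↦ lPolyGen(1+it)` is continuous and bounded by `Σ_l ‖c(l)‖`. [cite: Zhang2022LandauSiegel, §7 p.38] -/
theorem continuous_lPolyGen_line (D : ℕ) (c : ℕ → ℂ) (R : ℝ) (r h : ℕ) (θ : DirichletCharacter ℂ r) :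
    Continuous (fun t : ℝ => lPolyGen D c R r h θ (1 + t * I)) ∧
      ∀ t : ℝ, ‖lPolyGen D c R r h θ (1 + t * I)‖ ≤
        ∑ l ∈ (natI D (R * h)).filter (fun l => Nat.Coprime l h), ‖c l‖ := by
  have hlpos : ∀ l ∈ (natI D (R * h)).filter (fun l => Nat.Coprime l h), 0 < l := by
    intro l hl
    exact ((Finset.mem_filter.mp (Finset.mem_filter.mp hl).1).2).1
  constructor
  · unfold lPolyGen
    refine continuous_finsetSum _ fun l hl => ?_
    have hl0 : (0 : ℝ) < l := by exact_mod_cast hlpos l hl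
    have := continuous_cpow_neg_line hl0
    simp only [Complex.ofReal_natCast] at this
    exact continuous_const.mul this
  · intro t
    unfold lPolyGen
    refine (norm_sum_le _ _).trans (Finset.sum_le_sum fun l hl => ?_)
    have hl0 : (0 : ℝ) < l := by exact_mod_cast hlpos l hl
    have hn : ‖((l : ℕ) : ℂ) ^ (-(1 + (t : ℂ) * I))‖ = (l : ℝ)⁻¹ := by
      have := (norm_cpow_line hl0 t).1
      simpa using this
    rw [norm_mul, norm_mul, hn]
    have h1 : ‖θ (l : ZMod r)‖ ≤ 1 := θ.norm_le_one _
    have h2 : (l : ℝ)⁻¹ ≤ 1 := inv_le_one_of_one_le₀ (by exact_mod_cast hlpos l hl)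
    calc ‖c l‖ * ‖θ (l : ZMod r)‖ * (l : ℝ)⁻¹ ≤ ‖c l‖ * 1 * 1 := by gcongr
      _ = _ := by ring

/-- `t ↦ pPolyGen(1+it)` is continuous and bounded by `Σ_{p∼P} ‖w(p)θ̄(p)‖·p`.
[cite: Zhang2022LandauSiegel, §7 (7.14) p.38] -/
theorem continuous_pPolyGen_line (D : ℕ) (w : ℕ → ℂ) (r : ℕ) (θ : DirichletCharacter ℂ r) :
    Continuous (fun t : ℝ => pPolyGen D w r θ (1 + t * I)) ∧
      ∀ t : ℝ, ‖pPolyGen D w r θ (1 + t * I)‖ ≤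
        ∑ p ∈ primeWindow D, ‖w p * θ⁻¹ (p : ZMod r)‖ * p := by
  constructor
  · have hc : Continuous fun t : ℝ =>
        ∑ p ∈ primeWindow D, (w p * θ⁻¹ (p : ZMod r)) * (p : ℂ) ^ (1 + (t : ℂ) * I) := by
      refine continuous_finsetSum _ fun p hp => ?_
      have hp0 : (0 : ℝ) < p := by exact_mod_cast (Finset.mem_filter.mp hp).2.pos
      have := continuous_cpow_line hp0
      simp only [Complex.ofReal_natCast] at this
      exact continuous_const.mul this
    exact hc.congr fun t => primeSum_eq_pPolyGen D w r θ t
  · intro t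
    rw [← primeSum_eq_pPolyGen]
    refine (norm_sum_le _ _).trans (Finset.sum_le_sum fun p hp => ?_)
    have hp : 0 < p := (Finset.mem_filter.mp hp).2.pos
    rw [norm_mul, Complex.norm_natCast_cpow_of_pos hp]
    simp

/-! ### §2. The exact Mellin identity for `𝔰*` -/

/-- **The Mellin step for `𝔰*`, exact, generic coefficients.** For all large `D`: for every `c, w, R`,
every `h, r ≥ 1` and every character `θ (mod r)`,
`𝔰*(R,r,h;θ) = (1/2π)∫ δ(1+it)·(hr)^{1+it}·lPolyGen(1+it)·pPolyGen(1+it) dt` — "By the Mellin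
transform": `Δ(l/(phr)) = (1/2π)∫(l/(phr))^{−(1+it)}δ(1+it)dt` (tree `Skeleton.DeltaW_eq_mellinInv`)
inserted into the finite double sum defining `𝔰*` (Z22 §7.u038 p.38; §14 p.79 "similar").
[cite: Zhang2022LandauSiegel, §7 p.38, tex L2043; §14 p.79, tex L3962] -/
theorem frakSstarGen_eq_integral :
    ForAllLarge fun D _ _ => ∀ (c w : ℕ → ℂ) (R : ℝ) (r h : ℕ) (θ : DirichletCharacter ℂ r),
      0 < r → 0 < h →
        frakSstarGen D c w R r h θ = ((1 / (2 * π) : ℝ) : ℂ) *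
          ∫ t : ℝ, deltaW D (1 + t * I) * (((h * r : ℕ) : ℝ) : ℂ) ^ (1 + (t : ℂ) * I) *
            lPolyGen D c R r h θ (1 + t * I) * pPolyGen D w r θ (1 + t * I) := by
  obtain ⟨D₀, hall⟩ := DeltaW_eq_mellinInv.and integrable_deltaW_line
  refine ⟨D₀, fun D _ χ hD hq hp c w R r h θ hr hh => ?_⟩
  obtain ⟨hinv, hint⟩ := hall D χ hD hq hp
  set S : Finset ℕ := (natI D (R * h)).filter (fun l => Nat.Coprime l h) with hS
  have hlpos : ∀ l ∈ S, 0 < l := fun l hl =>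
    ((Finset.mem_filter.mp (Finset.mem_filter.mp hl).1).2).1
  have hhr : (0 : ℝ) < ((h * r : ℕ) : ℝ) := by exact_mod_cast Nat.mul_pos hh hr
  have inner : ∀ l ∈ S,
      ∑ p ∈ primeWindow D, w p * θ⁻¹ (p : ZMod r) * DeltaW D ((l : ℝ) / ((p : ℝ) * h * r))
        = ((1 / (2 * π) : ℝ) : ℂ) * ∫ t : ℝ, deltaW D (1 + t * I) *
            ((((h * r : ℕ) : ℝ) : ℂ) ^ (1 + (t : ℂ) * I) * ((l : ℕ) : ℂ) ^ (-(1 + (t : ℂ) * I))) *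
              pPolyGen D w r θ (1 + t * I) := by
    intro l hl
    have hl0 : (0 : ℝ) < l := by exact_mod_cast hlpos l hl
    set cc : ℝ := (l : ℝ) / ((h * r : ℕ) : ℝ) with hcdef
    have hc : 0 < cc := by positivity
    have e1 : ∀ p : ℕ, (l : ℝ) / ((p : ℝ) * h * r) = cc / p := by
      intro p; rw [hcdef]; push_cast; rw [div_div]; ring_nf
    have hFint : ∀ p ∈ primeWindow D, Integrable fun t : ℝ =>
        (w p * θ⁻¹ (p : ZMod r)) *
          ((((cc / p : ℝ)) : ℂ) ^ (-(1 + t * I)) * deltaW D (1 + t * I)) := by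
      intro p hp'
      have hpp : 0 < p := (Finset.mem_filter.mp hp').2.pos
      have hx : 0 < cc / p := by positivity
      exact (hint.bdd_mul (continuous_cpow_neg_line hx).aestronglyMeasurable
        (Eventually.of_forall fun t => (norm_cpow_line hx t).1.le)).const_mul _
    calc ∑ p ∈ primeWindow D, w p * θ⁻¹ (p : ZMod r) * DeltaW D ((l : ℝ) / ((p : ℝ) * h * r))
        = ∑ p ∈ primeWindow D, (w p * θ⁻¹ (p : ZMod r)) * DeltaW D (cc / p) := by
          refine Finset.sum_congr rfl fun p _ => ?_
          rw [e1]
      _ = ((1 / (2 * π) : ℝ) : ℂ) * ∫ t : ℝ, ∑ p ∈ primeWindow D,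
            (w p * θ⁻¹ (p : ZMod r)) *
              ((((cc / p : ℝ)) : ℂ) ^ (-(1 + t * I)) * deltaW D (1 + t * I)) := by
          rw [integral_finsetSum _ hFint, Finset.mul_sum]
          refine Finset.sum_congr rfl fun p hp' => ?_
          have hpp : 0 < p := (Finset.mem_filter.mp hp').2.pos
          have hx : 0 < cc / p := by positivity
          rw [hinv _ hx, integral_const_mul, Complex.real_smul]
          simp_rw [smul_eq_mul]
          ring
      _ = ((1 / (2 * π) : ℝ) : ℂ) * ∫ t : ℝ, deltaW D (1 + t * I) *
            ((((h * r : ℕ) : ℝ) : ℂ) ^ (1 + (t : ℂ) * I) * ((l : ℕ) : ℂ) ^ (-(1 + (t : ℂ) * I))) *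
              pPolyGen D w r θ (1 + t * I) := by
          congr 1
          refine integral_congr_ae (Eventually.of_forall fun t => ?_)
          have e2 : ∑ p ∈ primeWindow D, (w p * θ⁻¹ (p : ZMod r)) *
              ((((cc / p : ℝ)) : ℂ) ^ (-(1 + t * I)) * deltaW D (1 + t * I))
              = (∑ p ∈ primeWindow D, (w p * θ⁻¹ (p : ZMod r)) *
                  (((cc / p : ℝ)) : ℂ) ^ (-(1 + t * I))) * deltaW D (1 + t * I) := by
            rw [Finset.sum_mul]; exact Finset.sum_congr rfl fun p _ => by ring
          have e3 : ∑ p ∈ primeWindow D, (w p * θ⁻¹ (p : ZMod r)) *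
              (((cc / p : ℝ)) : ℂ) ^ (-(1 + t * I))
              = ((cc⁻¹ : ℝ) : ℂ) ^ (1 + (t : ℂ) * I) * pPolyGen D w r θ (1 + t * I) := by
            rw [← primeSum_eq_pPolyGen, Finset.mul_sum]
            refine Finset.sum_congr rfl fun p hp' => ?_
            have hpp : 0 < p := (Finset.mem_filter.mp hp').2.pos
            rw [cpow_kernel_eq hc hpp t]; ring
          have e4 : ((cc⁻¹ : ℝ) : ℂ) ^ (1 + (t : ℂ) * I) =
              (((h * r : ℕ) : ℝ) : ℂ) ^ (1 + (t : ℂ) * I) * ((l : ℕ) : ℂ) ^ (-(1 + (t : ℂ) * I)) := by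
            rw [hcdef, inv_div, cpow_div_eq hhr hl0]
            norm_cast
          simp only [e2, e3, e4]
          ring
  have hLint : ∀ l ∈ S, Integrable fun t : ℝ =>
      (c l * θ (l : ZMod r)) *
        (deltaW D (1 + t * I) *
          ((((h * r : ℕ) : ℝ) : ℂ) ^ (1 + (t : ℂ) * I) * ((l : ℕ) : ℂ) ^ (-(1 + (t : ℂ) * I))) *
          pPolyGen D w r θ (1 + t * I)) := by
    intro l hl
    have hl0 : (0 : ℝ) < l := by exact_mod_cast hlpos l hl
    obtain ⟨hpc, hpb⟩ := continuous_pPolyGen_line D w r θ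
    have hc1 : Continuous fun t : ℝ =>
        ((((h * r : ℕ) : ℝ) : ℂ) ^ (1 + (t : ℂ) * I) * ((l : ℕ) : ℂ) ^ (-(1 + (t : ℂ) * I))) *
          pPolyGen D w r θ (1 + t * I) := by
      have h1 := continuous_cpow_line hhr
      have h2 := continuous_cpow_neg_line hl0
      simp only [Complex.ofReal_natCast] at h2
      exact (h1.mul h2).mul hpc
    have hbd : ∀ t : ℝ, ‖((((h * r : ℕ) : ℝ) : ℂ) ^ (1 + (t : ℂ) * I) *
        ((l : ℕ) : ℂ) ^ (-(1 + (t : ℂ) * I))) * pPolyGen D w r θ (1 + t * I)‖ ≤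
        ((h * r : ℕ) : ℝ) * (l : ℝ)⁻¹ *
          ∑ p ∈ primeWindow D, ‖w p * θ⁻¹ (p : ZMod r)‖ * p := by
      intro t
      have n1 := (norm_cpow_line hhr t).2
      have n2 : ‖((l : ℕ) : ℂ) ^ (-(1 + (t : ℂ) * I))‖ = (l : ℝ)⁻¹ := by
        have := (norm_cpow_line hl0 t).1; simpa using this
      rw [norm_mul, norm_mul, n1, n2]
      gcongr
      exact hpb t
    have := hint.mul_bdd hc1.aestronglyMeasurable (Eventually.of_forall hbd)
    exact (this.congr (Eventually.of_forall fun t => by ring)).const_mul _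
  unfold frakSstarGen
  rw [show (natI D (R * h)).filter (fun l => Nat.Coprime l h) = S from rfl]
  calc ∑ l ∈ S, c l * θ (l : ZMod r) *
          ∑ p ∈ primeWindow D, w p * θ⁻¹ (p : ZMod r) * DeltaW D ((l : ℝ) / ((p : ℝ) * h * r))
      = ∑ l ∈ S, ((1 / (2 * π) : ℝ) : ℂ) * ∫ t : ℝ,
          (c l * θ (l : ZMod r)) *
            (deltaW D (1 + t * I) *
              ((((h * r : ℕ) : ℝ) : ℂ) ^ (1 + (t : ℂ) * I) * ((l : ℕ) : ℂ) ^ (-(1 + (t : ℂ) * I))) *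
              pPolyGen D w r θ (1 + t * I)) := by
        refine Finset.sum_congr rfl fun l hl => ?_
        rw [inner l hl, integral_const_mul]
        ring
    _ = ((1 / (2 * π) : ℝ) : ℂ) * ∫ t : ℝ, ∑ l ∈ S,
          (c l * θ (l : ZMod r)) *
            (deltaW D (1 + t * I) *
              ((((h * r : ℕ) : ℝ) : ℂ) ^ (1 + (t : ℂ) * I) * ((l : ℕ) : ℂ) ^ (-(1 + (t : ℂ) * I))) *
              pPolyGen D w r θ (1 + t * I)) := by
        rw [integral_finsetSum _ hLint, Finset.mul_sum]
    _ = _ := by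
        congr 1
        refine integral_congr_ae (Eventually.of_forall fun t => ?_)
        simp only [lPolyGen, hS, Finset.sum_mul, Finset.mul_sum]
        refine Finset.sum_congr rfl fun l _ => ?_
        ring

/-! ### §3. The bound with the exact weight, and with Lemma 5.4 (i) -/

/-- **`|𝔰*| ≤ hr·(1/2π)·∫|δ(1+it)|·|lPolyGen(1+it)|·|pPolyGen(1+it)| dt`**, generic coefficients, for
all large `D` (every `c, w, R`, `h, r ≥ 1`, `θ mod r`), with the integrand integrable — the Mellin step
for `𝔰*` BEFORE Lemma 5.4 (i) replaces `|δ(1+it)|` by `𝓛^c/(1+t²)`; note the factor `hr = |(hr)^{1+it}|`.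
[cite: Zhang2022LandauSiegel, §7 p.38, tex L2043; §14 p.79] -/
theorem norm_frakSstarGen_le :
    ForAllLarge fun D _ _ => ∀ (c w : ℕ → ℂ) (R : ℝ) (r h : ℕ) (θ : DirichletCharacter ℂ r),
      0 < r → 0 < h →
        Integrable (fun t : ℝ => ‖deltaW D (1 + t * I)‖ *
            (‖lPolyGen D c R r h θ (1 + t * I)‖ * ‖pPolyGen D w r θ (1 + t * I)‖)) ∧
        ‖frakSstarGen D c w R r h θ‖ ≤ ((h * r : ℕ) : ℝ) * (1 / (2 * π)) *
          ∫ t : ℝ, ‖deltaW D (1 + t * I)‖ *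
            (‖lPolyGen D c R r h θ (1 + t * I)‖ * ‖pPolyGen D w r θ (1 + t * I)‖) := by
  obtain ⟨D₀, hall⟩ := frakSstarGen_eq_integral.and integrable_deltaW_line
  refine ⟨D₀, fun D _ χ hD hq hp c w R r h θ hr hh => ?_⟩
  obtain ⟨heq, hint⟩ := hall D χ hD hq hp
  have hhr : (0 : ℝ) < ((h * r : ℕ) : ℝ) := by exact_mod_cast Nat.mul_pos hh hr
  obtain ⟨hlc, hlb⟩ := continuous_lPolyGen_line D c R r h θ
  obtain ⟨hpc, hpb⟩ := continuous_pPolyGen_line D w r θ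
  set Bl : ℝ := ∑ l ∈ (natI D (R * h)).filter (fun l => Nat.Coprime l h), ‖c l‖ with hBl
  set Bp : ℝ := ∑ p ∈ primeWindow D, ‖w p * θ⁻¹ (p : ZMod r)‖ * p with hBp
  have hBl0 : 0 ≤ Bl := by rw [hBl]; positivity
  have hbound : ∀ t : ℝ,
      ‖‖lPolyGen D c R r h θ (1 + t * I)‖ * ‖pPolyGen D w r θ (1 + t * I)‖‖ ≤ Bl * Bp := by
    intro t
    rw [Real.norm_of_nonneg (by positivity)]
    exact mul_le_mul (hlb t) (hpb t) (norm_nonneg _) hBl0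
  have hI : Integrable (fun t : ℝ => ‖deltaW D (1 + t * I)‖ *
      (‖lPolyGen D c R r h θ (1 + t * I)‖ * ‖pPolyGen D w r θ (1 + t * I)‖)) :=
    hint.norm.mul_bdd (hlc.norm.mul hpc.norm).aestronglyMeasurable (Eventually.of_forall hbound)
  refine ⟨hI, ?_⟩
  rw [heq c w R r h θ hr hh, norm_mul, Complex.norm_real,
    Real.norm_of_nonneg (by positivity : (0 : ℝ) ≤ 1 / (2 * π))]
  have hpt : ∀ t : ℝ, ‖deltaW D (1 + t * I) * (((h * r : ℕ) : ℝ) : ℂ) ^ (1 + (t : ℂ) * I) *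
      lPolyGen D c R r h θ (1 + t * I) * pPolyGen D w r θ (1 + t * I)‖ =
      ((h * r : ℕ) : ℝ) * (‖deltaW D (1 + t * I)‖ *
        (‖lPolyGen D c R r h θ (1 + t * I)‖ * ‖pPolyGen D w r θ (1 + t * I)‖)) := by
    intro t
    rw [norm_mul, norm_mul, norm_mul, (norm_cpow_line hhr t).2]
    ring
  calc 1 / (2 * π) * ‖∫ t : ℝ, deltaW D (1 + t * I) * (((h * r : ℕ) : ℝ) : ℂ) ^ (1 + (t : ℂ) * I) *
          lPolyGen D c R r h θ (1 + t * I) * pPolyGen D w r θ (1 + t * I)‖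
      ≤ 1 / (2 * π) * ∫ t : ℝ, ‖deltaW D (1 + t * I) * (((h * r : ℕ) : ℝ) : ℂ) ^ (1 + (t : ℂ) * I) *
          lPolyGen D c R r h θ (1 + t * I) * pPolyGen D w r θ (1 + t * I)‖ :=
        mul_le_mul_of_nonneg_left (norm_integral_le_integral_norm _) (by positivity)
    _ = ((h * r : ℕ) : ℝ) * (1 / (2 * π)) * ∫ t : ℝ, ‖deltaW D (1 + t * I)‖ *
          (‖lPolyGen D c R r h θ (1 + t * I)‖ * ‖pPolyGen D w r θ (1 + t * I)‖) := by
        simp_rw [hpt]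
        rw [integral_const_mul]
        ring

/-- The absolute constant of Lemma 5.4 (i) on the line `σ = 1` in the tree's explicit form
(`Skeleton.norm_deltaW_line_le`: `‖δ(1+it)‖ ≤ K₅₄·𝓛⁵¹⁹⁰/(1+t²)` for `D ≥ 3`).
[cite: Zhang2022LandauSiegel, §5 Lemma 5.4 (i) p.28] -/
def K54 : ℝ :=
  2 * Lemma53.Jconst 1 2 + 4 * ((2 + Real.exp 1) * (4 * π) ^ 2 * Real.exp (((5 : ℕ) : ℝ) ^ 2)
    + (Real.exp 1 * ((2 * 5).factorial : ℝ) + 5 ^ 5) * Lemma53.Jconst 1 2)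

/-- `K₅₄ ≥ 0`. [cite: Zhang2022LandauSiegel, §5 Lemma 5.4 (i) p.28] -/
theorem K54_nonneg : 0 ≤ K54 := by
  have hJ0 : 0 ≤ Lemma53.Jconst 1 2 := Lemma53.Jconst_nonneg' 1 2
  unfold K54
  positivity

/-- Lemma 5.4 (i) on `σ = 1` with the named constant: `‖δ(1+it)‖ ≤ K₅₄·𝓛⁵¹⁹⁰·(1+t²)⁻¹` (`D ≥ 3`).
[cite: Zhang2022LandauSiegel, §5 Lemma 5.4 (i) p.28] -/
theorem norm_deltaW_line_le_K54 {D : ℕ} (hD : 3 ≤ D) (t : ℝ) :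
    ‖deltaW D (1 + t * I)‖ ≤ K54 * ell D ^ 5190 * (1 + t ^ 2)⁻¹ :=
  norm_deltaW_line_le hD t

/-- **The Mellin step with Lemma 5.4 (i), generic coefficients** (Z22 §7.u038 / §14 p.79 "by the
Mellin transform and Lemma 5.4 (i)", with the factor `hr` restored, cf. GAP-LEDGER G-d26-1): for all
large `D`, every `c, w, R`, `h, r ≥ 1`, `θ (mod r)`:
`|𝔰*(R,r,h;θ)| ≤ K₅₄/(2π)·𝓛⁵¹⁹⁰·hr·∫|lPolyGen(1+it)|·|pPolyGen(1+it)|dt/(1+t²)`, and the right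
integrand is integrable. [cite: Zhang2022LandauSiegel, §7 p.38, tex L2043; §14 p.79, tex L3962] -/
theorem norm_frakSstarGen_le_ellPow :
    ForAllLarge fun D _ _ => ∀ (c w : ℕ → ℂ) (R : ℝ) (r h : ℕ) (θ : DirichletCharacter ℂ r),
      0 < r → 0 < h →
        Integrable (fun t : ℝ =>
            ‖lPolyGen D c R r h θ (1 + t * I)‖ * ‖pPolyGen D w r θ (1 + t * I)‖ / (1 + t ^ 2)) ∧
        ‖frakSstarGen D c w R r h θ‖ ≤
          K54 * (1 / (2 * π)) * ell D ^ 5190 * ((h * r : ℕ) : ℝ) *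
            ∫ t : ℝ, ‖lPolyGen D c R r h θ (1 + t * I)‖ * ‖pPolyGen D w r θ (1 + t * I)‖ /
              (1 + t ^ 2) := by
  obtain ⟨D₀, hall⟩ := norm_frakSstarGen_le
  refine ⟨max D₀ 3, fun D _ χ hD hq hp c w R r h θ hr hh => ?_⟩
  have hD3 : 3 ≤ D := le_trans (le_max_right _ _) hD
  obtain ⟨hI, hle⟩ := hall D χ (le_trans (le_max_left _ _) hD) hq hp c w R r h θ hr hh
  obtain ⟨hlc, hlb⟩ := continuous_lPolyGen_line D c R r h θ
  obtain ⟨hpc, hpb⟩ := continuous_pPolyGen_line D w r θ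
  set F : ℝ → ℝ := fun t =>
    ‖lPolyGen D c R r h θ (1 + t * I)‖ * ‖pPolyGen D w r θ (1 + t * I)‖ with hF
  have hBl0 : 0 ≤ ∑ l ∈ (natI D (R * h)).filter (fun l => Nat.Coprime l h), ‖c l‖ := by positivity
  have hbdd : Integrable fun t : ℝ => (1 + t ^ 2)⁻¹ * F t :=
    integrable_inv_one_add_sq.mul_bdd (hlc.norm.mul hpc.norm).aestronglyMeasurable
      (Eventually.of_forall fun t => by
        rw [Real.norm_of_nonneg (by positivity)]
        exact mul_le_mul (hlb t) (hpb t) (norm_nonneg _) hBl0)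
  have hbdd' : Integrable fun t : ℝ => F t / (1 + t ^ 2) :=
    hbdd.congr (Eventually.of_forall fun t => by simp only [div_eq_mul_inv, mul_comm])
  refine ⟨hbdd', ?_⟩
  have hmaj : Integrable fun t : ℝ => K54 * ell D ^ 5190 * ((1 + t ^ 2)⁻¹ * F t) := hbdd.const_mul _
  have hcmp : ∫ t : ℝ, ‖deltaW D (1 + t * I)‖ * F t ≤ K54 * ell D ^ 5190 * ∫ t : ℝ, F t / (1 + t ^ 2) := by
    calc ∫ t : ℝ, ‖deltaW D (1 + t * I)‖ * F t
        ≤ ∫ t : ℝ, K54 * ell D ^ 5190 * ((1 + t ^ 2)⁻¹ * F t) := by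
          refine integral_mono hI hmaj fun t => ?_
          have h1 := norm_deltaW_line_le_K54 hD3 t
          have hF0 : 0 ≤ F t := by rw [hF]; positivity
          calc ‖deltaW D (1 + t * I)‖ * F t ≤ K54 * ell D ^ 5190 * (1 + t ^ 2)⁻¹ * F t :=
                mul_le_mul_of_nonneg_right h1 hF0
            _ = _ := by ring
      _ = K54 * ell D ^ 5190 * ∫ t : ℝ, F t / (1 + t ^ 2) := by
          rw [integral_const_mul]
          congr 1
          exact integral_congr_ae (Eventually.of_forall fun t => by
            simp only [div_eq_mul_inv, mul_comm])
  have hhr0 : (0 : ℝ) ≤ ((h * r : ℕ) : ℝ) := Nat.cast_nonneg _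
  calc ‖frakSstarGen D c w R r h θ‖
      ≤ ((h * r : ℕ) : ℝ) * (1 / (2 * π)) * ∫ t : ℝ, ‖deltaW D (1 + t * I)‖ * F t := hle
    _ ≤ ((h * r : ℕ) : ℝ) * (1 / (2 * π)) * (K54 * ell D ^ 5190 * ∫ t : ℝ, F t / (1 + t ^ 2)) :=
        mul_le_mul_of_nonneg_left hcmp (by positivity)
    _ = K54 * (1 / (2 * π)) * ell D ^ 5190 * ((h * r : ℕ) : ℝ) *
          ∫ t : ℝ, F t / (1 + t ^ 2) := by ring

/-! ### §4. The localisation `𝔰 ↦ 𝔰*` (terms with `l ∉ 𝔌(Rh)` are negligible) -/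

/-- If `f = Σ' F`, `f* = Σ_{l∈S} F` and `‖F l‖ ≤ g l` off `S` with `g ≥ 0` summable, then
`‖f − f*‖ ≤ Σ' g`. [folklore] -/
private theorem norm_sub_le_of_tsum {f fstar : ℂ} {F : ℕ → ℂ} {g : ℕ → ℝ} (S : Finset ℕ)
    (hf : f = ∑' l, F l) (hfstar : fstar = ∑ l ∈ S, F l) (hg : Summable g)
    (hg0 : ∀ l, 0 ≤ g l) (hFg : ∀ l, l ∉ S → ‖F l‖ ≤ g l) : ‖f - fstar‖ ≤ ∑' l, g l := by
  set U : ℕ → ℂ := fun l => if l ∈ S then 0 else F l with hU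
  set V : ℕ → ℂ := fun l => if l ∈ S then F l else 0 with hV
  have hUg : ∀ l, ‖U l‖ ≤ g l := fun l => by
    by_cases hl : l ∈ S
    · simp only [hU, if_pos hl, norm_zero]; exact hg0 l
    · simp only [hU, if_neg hl]; exact hFg l hl
  have hUs : Summable U := Summable.of_norm_bounded hg hUg
  have hVs : Summable V :=
    summable_of_ne_finset_zero (s := S) (fun l hl => by simp only [hV, if_neg hl])
  have hVsum : ∑' l, V l = ∑ l ∈ S, F l := by
    rw [tsum_eq_sum (s := S) (fun l hl => by simp only [hV, if_neg hl])]
    exact Finset.sum_congr rfl fun l hl => by simp only [hV, if_pos hl]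
  have htsum : ∑' l, F l = ∑' l, (V l + U l) :=
    tsum_congr fun l => by by_cases hl : l ∈ S <;> simp [hU, hV, hl]
  rw [hf, hfstar, htsum, hVs.tsum_add hUs, hVsum, add_sub_cancel_left]
  exact tsum_of_norm_bounded hg.hasSum hUg

/-- **The localisation `𝔰 ↦ 𝔰*`, generic coefficients** (Z22 §7.u037 [p.38, tex L2036] "By Lemma 5.1,
for `R ≤ r < 2R`, the terms with `l ∉ 𝔌(Rh)` in `𝔰(r,h,d;θ)` make a negligible contribution"; re-used
for the `D³ ≤ r < 2DP₄` leg of (14.8) and for (14.6), p. 79): there is an absolute `c > 0` such that for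
all large `D`, for all coefficients `c` with `|c(l)| ≤ B·(dl)⁴` (`l ≥ 0`), all prime weights `w` with
`|w(p)| ≤ W` on the window (`W ≥ 0`), all `1 ≤ d ≤ P`, `h ≥ 1`, `0 < R` with `hR ≤ P`, all
`R ≤ r < 2R` and every character `θ (mod r)`:
`|𝔰(r,h;θ) − 𝔰*(R,r,h;θ)| ≤ B·W·exp(−c𝓛¹⁰)`.
Proof: for `l ∉ 𝔌(Rh)` the point `x = l/(phr)` is at distance `≥ (3/5)t₀` from `t₀`
(`Section7TruncI.far_of_not_mem_natI`), where `‖Δ(x)‖ ≤ e^{−c₀𝓛¹⁰}x⁻⁶` (`DeltaFar.norm_DeltaW_le_of_far`,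
from Lemma 5.3); with `x⁻⁶ ≤ (4PhR)⁶l⁻⁶`, `#{p∼P} ≤ 3P`, `d, hR ≤ P` the discarded `l`-th term is
`≤ 12288·B·W·P¹⁷e^{−c₀𝓛¹⁰}·l⁻²`, and `P¹⁷Σl⁻² ≤ e^{(c₀/2)𝓛¹⁰}` for `𝓛` large.
[cite: Zhang2022LandauSiegel, §7 p.38, tex L2036; §14 p.79, tex L3962; §5 Lemma 5.3] -/
theorem norm_frakSGen_sub_frakSstarGen_le :
    ∃ c₁ : ℝ, 0 < c₁ ∧ ForAllLarge fun D _ _ =>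
      ∀ (c w : ℕ → ℂ) (B W : ℝ) (d : ℕ) (R : ℝ) (r h : ℕ) (θ : DirichletCharacter ℂ r),
        (∀ l : ℕ, ‖c l‖ ≤ B * ((d * l : ℕ) : ℝ) ^ 4) → (∀ p ∈ primeWindow D, ‖w p‖ ≤ W) → 0 ≤ W →
        0 < d → (d : ℝ) ≤ bigP D → 0 < h → 0 < R → (h : ℝ) * R ≤ bigP D →
        R ≤ (r : ℝ) → (r : ℝ) < 2 * R →
          ‖frakSGen D c w r h θ - frakSstarGen D c w R r h θ‖ ≤ B * W * Real.exp (-c₁ * ell D ^ 10) := by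
  obtain ⟨c₀, hc₀, D₁, hfar⟩ := DeltaFar.norm_DeltaW_le_of_far
  -- `Z = Σ_l l⁻²`
  have hZsum : Summable (fun l : ℕ => ((l : ℝ) ^ 2)⁻¹) :=
    Real.summable_nat_pow_inv.mpr one_lt_two
  set Z : ℝ := ∑' l : ℕ, ((l : ℝ) ^ 2)⁻¹ with hZ
  have hZ0 : 0 ≤ Z := tsum_nonneg fun l => by positivity
  set K : ℝ := 12288 * Z with hK
  have hK0 : 0 ≤ K := by positivity
  set M : ℝ := max 2 (2 / c₀ * (17 + Real.log (K + 1))) with hM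
  obtain ⟨D₂, hD₂⟩ := exists_nat_forall_le_ell M
  refine ⟨c₀ / 2, by positivity, max D₁ D₂, ?_⟩
  intro D _ χ hD hq hprim c w B W d R r h θ hc hw hW0 hd hdP hh hR0 hhR hrR hr2
  have hD₁ : D₁ ≤ D := le_trans (le_max_left _ _) hD
  have hMℓ : M ≤ ell D := hD₂ D (le_trans (le_max_right _ _) hD)
  have hℓ2 : 2 ≤ ell D := le_trans (le_max_left _ _) hMℓ
  have hℓM : 2 / c₀ * (17 + Real.log (K + 1)) ≤ ell D := le_trans (le_max_right _ _) hMℓ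
  have hℓ1 : 1 ≤ ell D := by linarith
  have hℓ0 : 0 < ell D := by linarith
  have hfarD := hfar D χ hD₁ hq hprim
  have hd0 : (0 : ℝ) < d := Nat.cast_pos.mpr hd
  have hB0 : 0 ≤ B := by
    have h1 := (norm_nonneg _).trans (hc 1)
    have h2 : (0 : ℝ) < ((d * 1 : ℕ) : ℝ) ^ 4 := by positivity
    nlinarith
  have hh0 : (0 : ℝ) < h := Nat.cast_pos.mpr hh
  have hr0 : (0 : ℝ) < r := lt_of_lt_of_le hR0 hrR
  have hP := bigP_pos D
  have hhR_le : (h : ℝ) * R ≤ bigP D := hhR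
  -- the parameters of the majorant
  set ε : ℝ := Real.exp (-c₀ * ell D ^ 10) with hε
  have hε0 : 0 < ε := Real.exp_pos _
  set X : ℝ := 4 * bigP D * h * R with hX
  have hX0 : 0 ≤ X := by positivity
  have hX_le : X ≤ 4 * bigP D ^ 2 := by
    calc X = 4 * bigP D * ((h : ℝ) * R) := by rw [hX]; ring
      _ ≤ 4 * bigP D * bigP D := mul_le_mul_of_nonneg_left hhR_le (by positivity)
      _ = 4 * bigP D ^ 2 := by ring
  set A : ℝ := B * (d : ℝ) ^ 4 * (3 * bigP D) * W * X ^ 6 * ε with hA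
  have hA0 : 0 ≤ A := by positivity
  set S : Finset ℕ := natI D (R * h) with hS
  -- reduce to the termwise bound off `S`
  have hgsum : Summable (fun l : ℕ => A * ((l : ℝ) ^ 2)⁻¹) := hZsum.mul_left A
  have hg0 : ∀ l : ℕ, 0 ≤ A * ((l : ℝ) ^ 2)⁻¹ := fun l => by positivity
  refine (norm_sub_le_of_tsum S
    (F := fun l => if Nat.Coprime l h then
      c l * θ (l : ZMod r) *
        ∑ p ∈ primeWindow D, w p * θ⁻¹ (p : ZMod r) * DeltaW D ((l : ℝ) / ((p : ℝ) * h * r))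
      else 0)
    rfl ?_ hgsum hg0 ?_).trans ?_
  · -- `𝔰* = Σ_{l ∈ S} F l`
    rw [frakSstarGen, Finset.sum_filter]
  · -- termwise bound off `S`
    intro l hlS
    rcases Nat.eq_zero_or_pos l with rfl | hl
    · have h0 : c 0 = 0 := by
        have := hc 0
        rw [mul_zero, Nat.cast_zero] at this
        norm_num at this
        exact this
      simp [h0]
    by_cases hcop : Nat.Coprime l h
    swap
    · rw [if_neg hcop, norm_zero]; exact hg0 l
    rw [if_pos hcop]
    have hl0 : (0 : ℝ) < l := Nat.cast_pos.mpr hl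
    -- the coefficient
    have hcl : ‖c l‖ ≤ B * ((d * l : ℕ) : ℝ) ^ 4 := hc l
    -- the `p`-sum
    have hinner : ‖∑ p ∈ primeWindow D, w p * θ⁻¹ (p : ZMod r) *
        DeltaW D ((l : ℝ) / ((p : ℝ) * h * r))‖ ≤ 3 * bigP D * (W * (ε * (X / l) ^ 6)) := by
      calc ‖∑ p ∈ primeWindow D, w p * θ⁻¹ (p : ZMod r) *
              DeltaW D ((l : ℝ) / ((p : ℝ) * h * r))‖
          ≤ ∑ p ∈ primeWindow D, ‖w p * θ⁻¹ (p : ZMod r) *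
              DeltaW D ((l : ℝ) / ((p : ℝ) * h * r))‖ := norm_sum_le _ _
        _ ≤ ∑ p ∈ primeWindow D, W * (ε * (X / l) ^ 6) := by
            refine Finset.sum_le_sum fun p hp => ?_
            have hp0 : (0 : ℝ) < p := pos_of_mem_primeWindow hp
            have hQ0 : 0 < (p : ℝ) * h * r := by positivity
            have hx0 : 0 < (l : ℝ) / ((p : ℝ) * h * r) := div_pos hl0 hQ0
            have hΔ := hfarD ((l : ℝ) / ((p : ℝ) * h * r)) hx0
              (Section7TruncI.far_of_not_mem_natI hℓ2 hR0 hh hrR hr2 hp hl hlS)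
            have hQX : (p : ℝ) * h * r ≤ X := by
              calc (p : ℝ) * h * r ≤ 2 * bigP D * h * (2 * R) :=
                    mul_le_mul (mul_le_mul_of_nonneg_right
                      (le_two_mul_bigP_of_mem_primeWindow hℓ1 hp) hh0.le) hr2.le hr0.le
                      (by positivity)
                _ = X := by rw [hX]; ring
            have hx6 : (((l : ℝ) / ((p : ℝ) * h * r)) ^ 6)⁻¹ ≤ (X / l) ^ 6 := by
              rw [← inv_pow, inv_div]
              exact pow_le_pow_left₀ (div_nonneg hQ0.le hl0.le)
                (div_le_div_of_nonneg_right hQX hl0.le) 6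
            rw [norm_mul, norm_mul]
            have hwp : ‖w p‖ ≤ W := hw p hp
            calc ‖w p‖ * ‖θ⁻¹ (p : ZMod r)‖ * ‖DeltaW D ((l : ℝ) / ((p : ℝ) * h * r))‖
                ≤ W * 1 * (ε * (((l : ℝ) / ((p : ℝ) * h * r)) ^ 6)⁻¹) :=
                  mul_le_mul (mul_le_mul hwp (DirichletCharacter.norm_le_one _ _) (norm_nonneg _) hW0)
                    hΔ (norm_nonneg _) (by positivity)
              _ ≤ W * (ε * (X / l) ^ 6) := by
                  rw [mul_one]
                  exact mul_le_mul_of_nonneg_left (mul_le_mul_of_nonneg_left hx6 hε0.le) hW0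
        _ = ((primeWindow D).card : ℝ) * (W * (ε * (X / l) ^ 6)) := by
            rw [Finset.sum_const, nsmul_eq_mul]
        _ ≤ 3 * bigP D * (W * (ε * (X / l) ^ 6)) :=
            mul_le_mul_of_nonneg_right (Section7TailP2.card_primeWindow_le hℓ1) (by positivity)
    have hBdl : 0 ≤ B * ((d * l : ℕ) : ℝ) ^ 4 := by positivity
    calc ‖c l * θ (l : ZMod r) *
            ∑ p ∈ primeWindow D, w p * θ⁻¹ (p : ZMod r) *
              DeltaW D ((l : ℝ) / ((p : ℝ) * h * r))‖
        = ‖c l‖ * ‖θ (l : ZMod r)‖ *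
            ‖∑ p ∈ primeWindow D, w p * θ⁻¹ (p : ZMod r) *
              DeltaW D ((l : ℝ) / ((p : ℝ) * h * r))‖ := by rw [norm_mul, norm_mul]
      _ ≤ B * ((d * l : ℕ) : ℝ) ^ 4 * 1 * (3 * bigP D * (W * (ε * (X / l) ^ 6))) :=
          mul_le_mul (mul_le_mul hcl (DirichletCharacter.norm_le_one _ _) (norm_nonneg _) hBdl)
            hinner (norm_nonneg _) (by rw [mul_one]; exact hBdl)
      _ = A * ((l : ℝ) ^ 2)⁻¹ := by
          rw [hA]
          have hl0' : (l : ℝ) ≠ 0 := hl0.ne'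
          push_cast
          field_simp
  · -- `Σ' g = A·Z ≤ B·W·exp(−(c₀/2)𝓛¹⁰)`
    rw [tsum_mul_left]
    have hd_le : (d : ℝ) ≤ bigP D := hdP
    have hA_le : A ≤ 12288 * (B * W) * bigP D ^ 17 * ε := by
      have h1 : (d : ℝ) ^ 4 ≤ bigP D ^ 4 := pow_le_pow_left₀ hd0.le hd_le 4
      have h2 : X ^ 6 ≤ (4 * bigP D ^ 2) ^ 6 := pow_le_pow_left₀ hX0 hX_le 6
      calc A = B * W * ((d : ℝ) ^ 4 * (3 * bigP D) * X ^ 6) * ε := by rw [hA]; ring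
        _ ≤ B * W * (bigP D ^ 4 * (3 * bigP D) * (4 * bigP D ^ 2) ^ 6) * ε := by
            apply mul_le_mul_of_nonneg_right _ hε0.le
            apply mul_le_mul_of_nonneg_left _ (mul_nonneg hB0 hW0)
            exact mul_le_mul (mul_le_mul_of_nonneg_right h1 (by positivity)) h2
              (pow_nonneg hX0 6) (by positivity)
        _ = 12288 * (B * W) * bigP D ^ 17 * ε := by ring
    have hP17 : bigP D ^ 17 = Real.exp (17 * ell D ^ 9) := by
      rw [bigP, ← Real.exp_nat_mul]; norm_num
    have hK1 : 0 < K + 1 := by linarith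
    have hKexp : K ≤ Real.exp (Real.log (K + 1)) := by
      rw [Real.exp_log hK1]; linarith
    have hlogK : 0 ≤ Real.log (K + 1) := Real.log_nonneg (by linarith)
    have hℓ9 : 1 ≤ ell D ^ 9 := one_le_pow₀ hℓ1
    have h1 : 17 + Real.log (K + 1) ≤ c₀ / 2 * ell D := by
      have h := mul_le_mul_of_nonneg_left hℓM (by positivity : (0 : ℝ) ≤ c₀ / 2)
      have e : c₀ / 2 * (2 / c₀ * (17 + Real.log (K + 1))) = 17 + Real.log (K + 1) := by
        field_simp
      linarith [e]
    have h2 : Real.log (K + 1) + 17 * ell D ^ 9 ≤ c₀ / 2 * ell D ^ 10 := by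
      calc Real.log (K + 1) + 17 * ell D ^ 9 ≤ (17 + Real.log (K + 1)) * ell D ^ 9 := by
            nlinarith
        _ ≤ c₀ / 2 * ell D * ell D ^ 9 := mul_le_mul_of_nonneg_right h1 (by positivity)
        _ = c₀ / 2 * ell D ^ 10 := by ring
    have hBW : 0 ≤ B * W := mul_nonneg hB0 hW0
    calc A * Z ≤ 12288 * (B * W) * bigP D ^ 17 * ε * Z := mul_le_mul_of_nonneg_right hA_le hZ0
      _ = B * W * (K * bigP D ^ 17 * ε) := by rw [hK]; ring
      _ ≤ B * W * (Real.exp (Real.log (K + 1)) * bigP D ^ 17 * ε) := by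
          apply mul_le_mul_of_nonneg_left _ hBW
          apply mul_le_mul_of_nonneg_right _ hε0.le
          exact mul_le_mul_of_nonneg_right hKexp (by positivity)
      _ = B * W * Real.exp (Real.log (K + 1) + 17 * ell D ^ 9 + -c₀ * ell D ^ 10) := by
          rw [hP17, hε, Real.exp_add, Real.exp_add]
      _ ≤ B * W * Real.exp (-(c₀ / 2) * ell D ^ 10) :=
          mul_le_mul_of_nonneg_left (Real.exp_le_exp.mpr (by linarith)) hBW

end Literature.NumberTheory.LFunctions.Zhang2022.BErrorChain
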